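import Literature.AlgebraicGeometry.ShimuraVarieties.UnitaryAuxiliaryTorusDatum
import Literature.AlgebraicGeometry.ShimuraVarieties.UnitaryAuxiliaryReflexBookkeeping
import Literature.NumberTheory.ComplexMultiplication.CMTypeGaloisClassesInduced
import Literature.NumberTheory.ComplexMultiplication.CMTypeCount
import Literature.NumberTheory.ComplexMultiplication.InducedCMType
import HarnessLib

/-!
# Adapted CM types with SMALL REFLEX from an imaginary quadratic subfield (induced CM types)

Topic `AlgebraicGeometry/ShimuraVarieties`; namespace `Literature.AlgebraicGeometry.ShimuraVarieties`, grouping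
sub-namespace `UnitaryCanonicalModel.Aux` (the carriers of `UnitaryAuxiliaryTorusDatum`, as in
`UnitaryAuxiliaryReflexBookkeeping`).  THEOREMS ONLY (no definition, no named fact, no instance).

Let `L` be a CM field, `τ : L →+* ℂ`, and `Φ` a CM type of `L`.  The auxiliary datum `(G × T₀, h_U × h_Φ)` of
[Liu2021, App. C Lem. C.14] needs `Φ` ADAPTED at `τ` (`IsAdapted L Φ τ` : `τ ∈ Φ`), and the descent of the canonical model
from `E♯(Φ) = τ(L)·E*(Φ)` to `τ(L)` is free exactly when `Φ` has SMALL REFLEX (`HasSmallReflex L Φ τ` : the reflex-trace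
field `E*(Φ) = ℚ(tr_Φ)` lies in `τ(L)`).  For `L/ℚ` Galois every CM type has small reflex
(`hasSmallReflex_of_isGalois`, [Shimura1998, §8.3 Prop. 28]).  This file records the second classical source of such CM
types, valid for NON-Galois `L` as well: if `L` contains an imaginary quadratic field `K₀` (`j : K₀ →+* L`), the CM type
INDUCED from `{τ ∘ j}` ([MilneCM2006, Ch. I §1 Prop. 1.18 (c)]: `ℚ(tr_{Ψ^L}) = ℚ(tr_Ψ)`; [Shimura1998, §8.4 Example (1)]:
the reflex of `(K₀; φ)` is `φ(K₀)`) is `τ`-adapted and has reflex-trace field `(τ ∘ j)(K₀) ⊆ τ(L)`: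

* `isAdapted_inducedCMType_single` — `Ind_{K₀}^{L} {τ ∘ j}` is `τ`-adapted;
* `hasSmallReflex_inducedCMType_single` — it has small reflex (tree: `traceField_inducedCMType_ringHom`,
  `CMTypeCount.traceField_single`);
* `exists_isAdapted_and_hasSmallReflex_of_quadraticSubfield` — hence `∃ Φ, IsAdapted L Φ τ ∧ HasSmallReflex L Φ τ` for
  every CM field containing an imaginary quadratic field;
* `exists_isAdapted_and_hasSmallReflex_of_isGalois` — the same conclusion for `L/ℚ` Galois (`exists_isAdapted`,
  `hasSmallReflex_of_isGalois`).

Statements and proofs are §16 of the cell's crux workfile `Cruxes/HDel/Lines/B1HeckeQuotientDescent.lean` (v10b,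
sha16 d4745cf876192b63).  Consumer: `Summits/HodgeConjecture/CorCM/HypDel/HypDelSmallReflexCaseOfF1` (`hDel♭ ⇐ F1` for every
CM field with an imaginary quadratic subfield).  HC_CM is proved only modulo the 7 printed citations until rung 0 closes;
nothing here discharges a binder.

## References
* [MilneCM2006] J. S. Milne, *Complex Multiplication* (2006), Ch. I §1 Prop. 1.18 (c).
* [Shimura1998] G. Shimura, *Abelian Varieties with Complex Multiplication and Modular Functions* (1998), §8.3 Prop. 28,
  §8.4 Example (1).
* [Liu2021] Y. Liu, Camb. J. Math. 9 (2021), App. C, Lem. C.14, Rem. C.15 (p. 113).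
* [Streng2010] M. Streng, *Complex multiplication of abelian surfaces*, thesis (2010), Ch. I Def. 3.2.
* [Deligne1979ShimuraVarieties] P. Deligne, *Variétés de Shimura*, PSPM 33.2 (1979), 2.3.1.
-/

set_option autoImplicit false

noncomputable section

open NumberField
open Literature.AlgebraicGeometry.Motives (CMType)
open Literature.NumberTheory.ComplexMultiplication (traceField inducedCMType traceField_inducedCMType_ringHom)

namespace Literature.AlgebraicGeometry.ShimuraVarieties

namespace UnitaryCanonicalModel

namespace Aux

/-- **The induced CM type `Ind_{K₀}^{L} {τ ∘ j}` is `τ`-adapted** (`τ ∘ j ∈ {τ ∘ j}`). [cite: Streng2010, Ch. I Def. 3.2]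
[cite: Deligne1979ShimuraVarieties, 2.3.1] -/
theorem isAdapted_inducedCMType_single {K₀ : Type} [Field K₀] [NumberField K₀] [IsTotallyComplex K₀]
    (h2 : Module.finrank ℚ K₀ = 2) {L : Type} [Field L] [NumberField L] [IsCMField L] (j : K₀ →+* L) (τ : L →+* ℂ) :
    IsAdapted L (inducedCMType j (Literature.NumberTheory.ComplexMultiplication.CMTypeCount.single h2 (τ.comp j))) τ := by
  unfold IsAdapted
  rw [Literature.NumberTheory.ComplexMultiplication.mem_inducedCMType_iff]
  exact Set.mem_singleton (τ.comp j)

/-- **The induced CM type `Ind_{K₀}^{L} {τ ∘ j}` has SMALL REFLEX: `E*(Φ) = ℚ(tr_Φ) = (τ ∘ j)(K₀) ⊆ τ(L)`** — Milne Prop. 1.18 (c)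
(`ℚ(tr_{Ψ^L}) = ℚ(tr_Ψ)`) and Shimura §8.4 Ex. (1) (the reflex of `(K₀; φ)` is `φ(K₀)`).
[cite: MilneCM2006, Ch. I §1 Prop. 1.18 (c)] [cite: Shimura1998, §8.4 Example (1)] [cite: Liu2021, App. C Rem. C.15 (p. 113)] -/
theorem hasSmallReflex_inducedCMType_single {K₀ : Type} [Field K₀] [NumberField K₀] [IsTotallyComplex K₀]
    (h2 : Module.finrank ℚ K₀ = 2) {L : Type} [Field L] [NumberField L] [IsCMField L] (j : K₀ →+* L) (τ : L →+* ℂ) :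
    HasSmallReflex L (inducedCMType j (Literature.NumberTheory.ComplexMultiplication.CMTypeCount.single h2 (τ.comp j))) τ := by
  unfold HasSmallReflex
  rw [traceField_inducedCMType_ringHom, Literature.NumberTheory.ComplexMultiplication.CMTypeCount.traceField_single]
  intro z hz
  obtain ⟨x, hx⟩ := AlgHom.mem_fieldRange.1 hz
  exact AlgHom.mem_fieldRange.2 ⟨j x, by simpa using hx⟩

/-- **A CM field containing an imaginary quadratic field has a `τ`-adapted CM type with small reflex**, for every `τ`.
[cite: MilneCM2006, Ch. I §1 Prop. 1.18 (c)] [cite: Shimura1998, §8.4 Example (1)] -/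
theorem exists_isAdapted_and_hasSmallReflex_of_quadraticSubfield {K₀ : Type} [Field K₀] [NumberField K₀]
    [IsTotallyComplex K₀] (h2 : Module.finrank ℚ K₀ = 2) {L : Type} [Field L] [NumberField L] [IsCMField L]
    (j : K₀ →+* L) (τ : L →+* ℂ) :
    ∃ Φ : CMType L, IsAdapted L Φ τ ∧ HasSmallReflex L Φ τ :=
  ⟨_, isAdapted_inducedCMType_single h2 j τ, hasSmallReflex_inducedCMType_single h2 j τ⟩

/-- **A Galois CM field has a `τ`-adapted CM type with small reflex** (every CM type has small reflex:
`hasSmallReflex_of_isGalois`). [cite: Shimura1998, §8.3 Prop. 28] -/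
theorem exists_isAdapted_and_hasSmallReflex_of_isGalois (L : Type) [Field L] [NumberField L] [IsCMField L] [IsGalois ℚ L]
    (τ : L →+* ℂ) : ∃ Φ : CMType L, IsAdapted L Φ τ ∧ HasSmallReflex L Φ τ := by
  obtain ⟨Φ, hΦ⟩ := exists_isAdapted (L := L) τ
  exact ⟨Φ, hΦ, hasSmallReflex_of_isGalois L Φ τ⟩

end Aux

end UnitaryCanonicalModel

end Literature.AlgebraicGeometry.ShimuraVarieties

end
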